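import Summits.HodgeConjecture.HodgeConjecture.Theorems.GenericDivisibilityGenericDivisibilityBoundedInfinitePrimes
import Literature.AlgebraicGeometry.HodgeTheory.ZariskiOpenBettiFinitenessProofs
import Literature.AlgebraicTopology.SingularHomology.CohomologyFiniteness
import HarnessLib

/-!
# The fixed-witness no-go for generic divisibility (cruxes C1/C2 of route `GenericDivisibility`)

Crux C1 (`HodgeClassesGenericallyDivisible`, stmt-HodgeConjecture-18466) asks that an integral Hodge
class `z ∈ H^{2p}(X(ℂ);ℤ)` be divisible by every `m ≥ 1` on the complex points of SOME non-empty
Zariski open `X ∖ Z_m`, the witness `Z_m` being allowed to depend on `m`; crux C2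
(`GenericDivisibilityBounded`, stmt-HodgeConjecture-18467) asks that such a class have
complexification of coniveau `≥ 1`. This file records, sorry-free and Hodge-free, what happens when
the witness does NOT depend on the modulus ("census D3(a)", deciding triage `TRIAGE-r1-3.md` of the
crux: "any bounded witness family forces rational coniveau one" — here the fixed and the finite
family). Everything rests on ONE topological input, now a theorem of the tree: the integral
cohomology of the complex points of a Zariski open of a smooth projective complex variety is finitely
generated (Dimca 1992, Ch. 1 Cor. (6.10): `Dimca1992_finite_singularHomology_complexPointsCompl_holds`
+ universal coefficients, Hatcher Cor. 3.3).

* `genericDivisibility_eq_zero_of_forall_exists_nsmul_eq` — lattice algebra: in a finitely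
  generated abelian group an element divisible by every `m ≥ 1` is `0`.
* `genericDivisibility_exists_nsmul_eq_zero_of_forall_pow` — lattice algebra: an element divisible
  by every power of one integer `ℓ ≥ 2` is torsion (Krull).
* `genericDivisibility_finite_singularCohomology_complexPointsCompl` — `H^k((X∖Z)(ℂ);ℤ)` is finitely
  generated.
* `genericDivisibility_restrict_eq_zero_of_fixedWitness` — a class divisible by every `m` on ONE
  open vanishes there; `genericDivisibility_fixedWitness_iff_restrict_eq_zero` — uniform-in-`m`
  generic divisibility IS generic vanishing.
* `genericDivisibility_ringChange_mem_supportedClasses_of_fixedWitness` — **the no-go**: an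
  `m`-uniform witness forces complex coniveau `≥ 1` (the conclusion of C2, with no Hodge hypothesis);
  `…_of_fixedWitness_pow` — already an `r`-uniform witness for the powers of ONE prime forces it
  (the class is generically torsion); `…_of_finite_witnessFamily` — the same for witnesses ranging
  in a finite family.

Consequence for the cruxes (docstrings only, nothing is claimed about them): a proof of C1 — or of
the heart stub `stub_primePowerModularConiveau` at a single prime — whose witnesses `Z` do not grow
with the modulus proves that the Hodge class has RATIONAL coniveau `≥ 1` on the nose, i.e. the
Hodge conjecture in the middle degree up to torsion for that class; witness degrees must tend to
infinity in any genuine C1 mechanism.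

References: Dimca, *Singularities and Topology of Hypersurfaces* (1992) Ch. 1 Cor. (6.10);
Hatcher, *Algebraic Topology* §3.1 Cor. 3.3; Colliot-Thélène–Voisin, Duke Math. J. 161 (2012) §3
(context).
-/

set_option linter.dupNamespace false

noncomputable section

namespace Summit.HodgeConjecture.HodgeConjecture.Theorems

open CategoryTheory AlgebraicGeometry
open Literature.AlgebraicGeometry.Motives Literature.AlgebraicGeometry.HodgeTheory
  Literature.AlgebraicTopology.SingularHomology

/-- Restriction `H^k(X(ℂ);ℤ) → H^k((X∖Z)(ℂ);ℤ)`, the very term of the route decls (notation only). -/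
local notation3 (prettyPrint := false) "Res[" X ", " Z ", " k "]" =>
  singularCohomology.map ℤ ℤ
    (⟨Subtype.val, continuous_subtype_val⟩ : C(complexPointsCompl X Z, ComplexPoints X)) k

/-! ### Lattice algebra -/

/-- The torsion subgroup of an abelian group is saturated for `ℕ`-multiples:
`N • x` torsion and `N ≥ 1` imply `x` torsion. [folklore] -/
theorem genericDivisibility_mem_torsion_of_nsmul_mem {M : Type} [AddCommGroup M] (N : ℕ) (x : M)
    (hN : 1 ≤ N) (hx : N • x ∈ (Submodule.torsion ℤ M).toAddSubgroup) :
    x ∈ (Submodule.torsion ℤ M).toAddSubgroup := by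
  rw [Submodule.mem_toAddSubgroup, Submodule.mem_torsion_iff] at hx ⊢
  obtain ⟨⟨a, ha⟩, hax⟩ := hx
  refine ⟨⟨a * N, mul_mem ha (mem_nonZeroDivisors_of_ne_zero (by exact_mod_cast (by omega)))⟩, ?_⟩
  change (a * (N : ℤ)) • x = 0
  change a • (N • x) = 0 at hax
  rwa [mul_smul, natCast_zsmul]

/-- **Divisible by everything in a finitely generated abelian group means zero.** If `x = m • y_m`
for every `m ≥ 1` in a finitely generated abelian group `M`, then `x = 0`: `x` is torsion (it is
divisible by infinitely many primes modulo the saturated torsion subgroup, and `M/torsion` is free),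
the finitely generated torsion subgroup has an exponent `e ≥ 1`, and `x = e • y` with `y` torsion.
[folklore] -/
theorem genericDivisibility_eq_zero_of_forall_exists_nsmul_eq {M : Type} [AddCommGroup M]
    [Module.Finite ℤ M] {x : M} (hx : ∀ m : ℕ, 1 ≤ m → ∃ y : M, m • y = x) : x = 0 := by
  set T : Submodule ℤ M := Submodule.torsion ℤ M with hTdef
  -- Step 1: `x` is torsion
  have hxT : x ∈ T.toAddSubgroup := by
    refine genericDivisibilityBounded_mem_of_infinite_prime T.toAddSubgroup
      (fun N y hN hy ↦ genericDivisibility_mem_torsion_of_nsmul_mem N y hN hy) ?_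
    refine Nat.infinite_setOf_prime.mono fun ℓ hℓ ↦ ⟨hℓ, ?_⟩
    obtain ⟨w, hw⟩ := hx ℓ (Nat.Prime.one_lt hℓ).le
    exact ⟨w, by rw [hw, sub_self]; exact zero_mem _⟩
  -- Step 2: an exponent of the (finitely generated) torsion submodule
  haveI : Module.Finite ℤ T := Module.Finite.iff_fg.mpr (IsNoetherian.noetherian T)
  obtain ⟨a, haAnn, ha0⟩ :=
    Submodule.annihilator_top_inter_nonZeroDivisors (Submodule.torsion_isTorsion (R := ℤ) (M := M))
  have ha : ∀ t ∈ T, a • t = 0 := fun t ht ↦ by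
    have h := Submodule.mem_annihilator.1 haAnn ⟨t, ht⟩ Submodule.mem_top
    exact congrArg Subtype.val h
  have ha0' : a ≠ 0 := nonZeroDivisors.ne_zero ha0
  -- Step 3: `x = |a| • y` with `y` torsion, hence `x = ± a • y = 0`
  obtain ⟨y, hy⟩ := hx a.natAbs (Nat.one_le_iff_ne_zero.2 (Int.natAbs_ne_zero.2 ha0'))
  have hyT : y ∈ T.toAddSubgroup :=
    genericDivisibility_mem_torsion_of_nsmul_mem a.natAbs y
      (Nat.one_le_iff_ne_zero.2 (Int.natAbs_ne_zero.2 ha0')) (by rwa [hy])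
  have hay : a • y = 0 := ha y hyT
  rw [← hy, ← natCast_zsmul, ← Int.sign_mul_self_eq_natAbs, mul_zsmul, hay, zsmul_zero]

/-- **Divisible by every power of one integer means torsion.** If `x = ℓ^{r+1} • y_r` for every `r`
(`ℓ ≥ 2`) in a finitely generated abelian group, then `N • x = 0` for some `N ≥ 1`: Krull's
intersection theorem on the free quotient by the saturated torsion subgroup
(`genericDivisibilityBounded_krull`). The conclusion cannot be improved to `x = 0` (an element of
prime order `q ≠ ℓ` is `ℓ`-divisible to all orders). [folklore] -/
theorem genericDivisibility_exists_nsmul_eq_zero_of_forall_pow {M : Type} [AddCommGroup M]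
    [Module.Finite ℤ M] {ℓ : ℕ} (hℓ : 2 ≤ ℓ) {x : M} (hx : ∀ r : ℕ, ∃ y : M, ℓ ^ (r + 1) • y = x) :
    ∃ N : ℕ, 1 ≤ N ∧ N • x = 0 := by
  have hxT : x ∈ (Submodule.torsion ℤ M).toAddSubgroup := by
    refine genericDivisibilityBounded_krull (Submodule.torsion ℤ M).toAddSubgroup
      (fun N y hN hy ↦ genericDivisibility_mem_torsion_of_nsmul_mem N y hN hy) hℓ fun r ↦ ?_
    obtain ⟨w, hw⟩ := hx r
    exact ⟨w, by rw [hw, sub_self]; exact zero_mem _⟩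
  rw [Submodule.mem_toAddSubgroup, Submodule.mem_torsion_iff] at hxT
  obtain ⟨⟨a, ha⟩, hax⟩ := hxT
  have ha0 : a ≠ 0 := nonZeroDivisors.ne_zero ha
  refine ⟨a.natAbs, Nat.one_le_iff_ne_zero.2 (Int.natAbs_ne_zero.2 ha0), ?_⟩
  change a • x = 0 at hax
  rw [← natCast_zsmul, ← Int.sign_mul_self_eq_natAbs, mul_zsmul, hax, zsmul_zero]

/-! ### Finite generation of the integral cohomology of a Zariski open -/

/-- **`H^k((X ∖ Z)(ℂ); ℤ)` is finitely generated** for `X` smooth projective over `ℂ` and `Z`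
Zariski-closed: homology is finitely generated in all degrees (Dimca 1992 Ch. 1 Cor. (6.10), the
tree's theorem `Dimca1992_finite_singularHomology_complexPointsCompl_holds`) and cohomology follows
by universal coefficients (Hatcher Cor. 3.3, `finite_singularCohomology_of_finite_singularHomology`).
[cite: Dimca1992, Ch. 1 Cor. (6.10)] [cite: HatcherAT2002, §3.1 Cor. 3.3] -/
theorem genericDivisibility_finite_singularCohomology_complexPointsCompl {n₀ : ℕ} {X : SchemeOver ℂ}
    (hX : IsSmoothProjective n₀ X) {Z : Set X.left} (hZ : IsClosed Z) (k : ℕ) :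
    Module.Finite ℤ (singularCohomology ℤ ℤ (complexPointsCompl X Z) k) :=
  haveI : ∀ m, Module.Finite ℤ (singularHomology ℤ ℤ (complexPointsCompl X Z) m) := fun m ↦
    Dimca1992_finite_singularHomology_complexPointsCompl_holds hX Z hZ m
  finite_singularCohomology_of_finite_singularHomology k fun _ _ ↦ inferInstance

/-! ### Fixed witness: uniform generic divisibility is generic vanishing -/

/-- **A class divisible by every `m ≥ 1` on ONE Zariski open vanishes there**: for `X` smooth
projective over `ℂ`, `Z` closed and `x ∈ H^k((X∖Z)(ℂ);ℤ)` with `x = m • y_m` for all `m ≥ 1`,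
`x = 0` (finite generation + lattice algebra). [folklore] -/
theorem genericDivisibility_eq_zero_of_forall_exists_nsmul_eq_compl {n₀ : ℕ} {X : SchemeOver ℂ}
    (hX : IsSmoothProjective n₀ X) {Z : Set X.left} (hZ : IsClosed Z) {k : ℕ}
    {x : singularCohomology ℤ ℤ (complexPointsCompl X Z) k}
    (hx : ∀ m : ℕ, 1 ≤ m → ∃ y : singularCohomology ℤ ℤ (complexPointsCompl X Z) k, m • y = x) :
    x = 0 := by
  haveI : @Module.Finite ℤ (singularCohomology ℤ ℤ (complexPointsCompl X Z) k) _ _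
      (AddCommGroup.toIntModule _) := by
    convert genericDivisibility_finite_singularCohomology_complexPointsCompl hX hZ k
    exact Subsingleton.elim _ _
  exact genericDivisibility_eq_zero_of_forall_exists_nsmul_eq hx

/-- **A class `ℓ`-divisible to all orders on ONE Zariski open is torsion there** (`ℓ ≥ 2`):
`x = ℓ^{r+1} • y_r` for all `r` in `H^k((X∖Z)(ℂ);ℤ)` forces `N • x = 0` for some `N ≥ 1`.
[folklore] -/
theorem genericDivisibility_exists_nsmul_eq_zero_of_forall_pow_compl {n₀ : ℕ} {X : SchemeOver ℂ}
    (hX : IsSmoothProjective n₀ X) {Z : Set X.left} (hZ : IsClosed Z) {k ℓ : ℕ} (hℓ : 2 ≤ ℓ)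
    {x : singularCohomology ℤ ℤ (complexPointsCompl X Z) k}
    (hx : ∀ r : ℕ, ∃ y : singularCohomology ℤ ℤ (complexPointsCompl X Z) k, ℓ ^ (r + 1) • y = x) :
    ∃ N : ℕ, 1 ≤ N ∧ N • x = 0 := by
  haveI : @Module.Finite ℤ (singularCohomology ℤ ℤ (complexPointsCompl X Z) k) _ _
      (AddCommGroup.toIntModule _) := by
    convert genericDivisibility_finite_singularCohomology_complexPointsCompl hX hZ k
    exact Subsingleton.elim _ _
  exact genericDivisibility_exists_nsmul_eq_zero_of_forall_pow hℓ hx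

/-- **Fixed witness ⇒ vanishing.** If ONE closed `Z` witnesses the divisibility of
`z|_{(X∖Z)(ℂ)}` by every `m ≥ 1`, then `z|_{(X∖Z)(ℂ)} = 0`. [folklore] -/
theorem genericDivisibility_restrict_eq_zero_of_fixedWitness {n₀ : ℕ} {X : SchemeOver ℂ}
    (hX : IsSmoothProjective n₀ X) {Z : Set X.left} (hZ : IsClosed Z) {k : ℕ}
    (z : singularCohomology ℤ ℤ (ComplexPoints X) k)
    (h : ∀ m : ℕ, 1 ≤ m →
      ∃ y : singularCohomology ℤ ℤ (complexPointsCompl X Z) k, m • y = Res[X, Z, k] z) :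
    Res[X, Z, k] z = 0 :=
  genericDivisibility_eq_zero_of_forall_exists_nsmul_eq_compl hX hZ h

/-- **Uniform-in-`m` generic divisibility IS generic vanishing**: a class has an `m`-independent
witness of generic divisibility by all `m ≥ 1` iff it vanishes on the complex points of some
non-empty Zariski open. [folklore] -/
theorem genericDivisibility_fixedWitness_iff_restrict_eq_zero {n₀ : ℕ} {X : SchemeOver ℂ}
    (hX : IsSmoothProjective n₀ X) {k : ℕ} (z : singularCohomology ℤ ℤ (ComplexPoints X) k) :
    (∃ Z : Set X.left, IsClosed Z ∧ Z ≠ Set.univ ∧ ∀ m : ℕ, 1 ≤ m →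
        ∃ y : singularCohomology ℤ ℤ (complexPointsCompl X Z) k, m • y = Res[X, Z, k] z) ↔
      ∃ Z : Set X.left, IsClosed Z ∧ Z ≠ Set.univ ∧ Res[X, Z, k] z = 0 := by
  constructor
  · rintro ⟨Z, hZ, hZne, h⟩
    exact ⟨Z, hZ, hZne, genericDivisibility_restrict_eq_zero_of_fixedWitness hX hZ z h⟩
  · rintro ⟨Z, hZ, hZne, h⟩
    exact ⟨Z, hZ, hZne, fun m _ ↦ ⟨0, by rw [smul_zero, h]⟩⟩

/-! ### The no-go: bounded witnesses force coniveau one -/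

/-- **Fixed-witness no-go** (`fixedWitness_forces_coniveauOne` of the crux triage): on a smooth
projective complex `X`, an integral class `z ∈ H^k(X(ℂ);ℤ)` admitting ONE proper closed `Z` off which
it is divisible by every `m ≥ 1` has complexification in `supportedClasses X k 1` (coniveau `≥ 1`) —
the conclusion of crux C2, with no Hodge-type hypothesis and no Bloch–Kato. Hence any C1 mechanism
with `m`-independent witnesses proves rational coniveau one of the class outright. [folklore] -/
theorem genericDivisibility_ringChange_mem_supportedClasses_of_fixedWitness {n₀ : ℕ}
    {X : SchemeOver ℂ} (hX : IsSmoothProjective n₀ X) {k : ℕ}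
    {z : singularCohomology ℤ ℤ (ComplexPoints X) k}
    (h : ∃ Z : Set X.left, IsClosed Z ∧ Z ≠ Set.univ ∧ ∀ m : ℕ, 1 ≤ m →
      ∃ y : singularCohomology ℤ ℤ (complexPointsCompl X Z) k, m • y = Res[X, Z, k] z) :
    singularCohomology.ringChange (Int.castRingHom ℂ) (ComplexPoints X) k z ∈
      supportedClasses X k 1 := by
  obtain ⟨Z, hZ, hZne, h⟩ := h
  exact genericDivisibilityBounded_ringChange_mem_supportedClasses hX
    ⟨Z, hZ, hZne, 1, le_rfl, by
      rw [genericDivisibility_restrict_eq_zero_of_fixedWitness hX hZ z h, smul_zero]⟩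

/-- **One-prime fixed-witness no-go**: if ONE proper closed `Z` witnesses the divisibility of
`z|_{(X∖Z)(ℂ)}` by every power `ℓ^{r+1}` of a single integer `ℓ ≥ 2`, then `z` is generically
torsion and its complexification lies in `supportedClasses X k 1`. In particular a proof of the heart
stub `stub_primePowerModularConiveau` of crux C1 at one prime with `r`-independent witnesses would
give rational coniveau one of the Hodge class. [folklore] -/
theorem genericDivisibility_ringChange_mem_supportedClasses_of_fixedWitness_pow {n₀ : ℕ}
    {X : SchemeOver ℂ} (hX : IsSmoothProjective n₀ X) {k ℓ : ℕ} (hℓ : 2 ≤ ℓ)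
    {z : singularCohomology ℤ ℤ (ComplexPoints X) k}
    (h : ∃ Z : Set X.left, IsClosed Z ∧ Z ≠ Set.univ ∧ ∀ r : ℕ,
      ∃ y : singularCohomology ℤ ℤ (complexPointsCompl X Z) k, ℓ ^ (r + 1) • y = Res[X, Z, k] z) :
    singularCohomology.ringChange (Int.castRingHom ℂ) (ComplexPoints X) k z ∈
      supportedClasses X k 1 := by
  obtain ⟨Z, hZ, hZne, h⟩ := h
  obtain ⟨N, hN, hNz⟩ := genericDivisibility_exists_nsmul_eq_zero_of_forall_pow_compl hX hZ hℓ h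
  exact genericDivisibilityBounded_ringChange_mem_supportedClasses hX ⟨Z, hZ, hZne, N, hN, hNz⟩

/-- A finite union of proper Zariski-closed subsets of an irreducible scheme is a proper closed
subset. [folklore] -/
theorem genericDivisibility_sUnion_ne_univ {X : SchemeOver ℂ} [IrreducibleSpace X.left]
    {F : Set (Set X.left)} (hF : F.Finite) (hFc : ∀ Z ∈ F, IsClosed Z ∧ Z ≠ Set.univ) :
    IsClosed (⋃₀ F) ∧ ⋃₀ F ≠ Set.univ := by
  induction F, hF using Set.Finite.induction_on with
  | empty =>
    refine ⟨by rw [Set.sUnion_empty]; exact isClosed_empty, ?_⟩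
    rw [Set.sUnion_empty]
    exact fun h ↦ (Set.empty_ne_univ h).elim
  | @insert Z F _ _ ih =>
    have hZ := hFc Z (Set.mem_insert _ _)
    have ih' := ih fun Z' hZ' ↦ hFc Z' (Set.mem_insert_of_mem _ hZ')
    rw [Set.sUnion_insert]
    exact ⟨hZ.1.union ih'.1, genericDivisibilityBounded_union_ne_univ hZ.1 ih'.1 hZ.2 ih'.2⟩

/-- **Finite witness families are no better than a fixed witness**: if the witnesses `Z_m` of
generic divisibility by every `m ≥ 1` can be taken in a FINITE family of proper closed subsets,
the class has complexification in `supportedClasses X k 1` (pass to the union of the family, a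
proper closed subset since `X` is irreducible). Witness families in a genuine C1 mechanism must be
infinite. [folklore] -/
theorem genericDivisibility_ringChange_mem_supportedClasses_of_finite_witnessFamily {n₀ : ℕ}
    {X : SchemeOver ℂ} (hX : IsSmoothProjective n₀ X) {k : ℕ}
    {z : singularCohomology ℤ ℤ (ComplexPoints X) k} {F : Set (Set X.left)} (hF : F.Finite)
    (hFc : ∀ Z ∈ F, IsClosed Z ∧ Z ≠ Set.univ)
    (h : ∀ m : ℕ, 1 ≤ m → ∃ Z ∈ F,
      ∃ y : singularCohomology ℤ ℤ (complexPointsCompl X Z) k, m • y = Res[X, Z, k] z) :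
    singularCohomology.ringChange (Int.castRingHom ℂ) (ComplexPoints X) k z ∈
      supportedClasses X k 1 := by
  haveI : IsIntegral X.left := IsSmoothProjective.isIntegral_holds hX
  obtain ⟨hU, hUne⟩ := genericDivisibility_sUnion_ne_univ hF hFc
  refine genericDivisibility_ringChange_mem_supportedClasses_of_fixedWitness hX
    ⟨⋃₀ F, hU, hUne, fun m hm ↦ ?_⟩
  obtain ⟨Z, hZF, y, hy⟩ := h m hm
  have hsub : Z ⊆ ⋃₀ F := Set.subset_sUnion_of_mem hZF
  refine ⟨singularCohomology.map ℤ ℤ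
      (⟨fun P : complexPointsCompl X (⋃₀ F) => (⟨P.1, fun hP : P.1.pt ∈ Z => P.2 (hsub hP)⟩ :
          complexPointsCompl X Z),
        continuous_subtype_val.subtype_mk fun (P : complexPointsCompl X (⋃₀ F))
          (hP : P.1.pt ∈ Z) => P.2 (hsub hP)⟩ :
        C(complexPointsCompl X (⋃₀ F), complexPointsCompl X Z)) k y, ?_⟩
  rw [← map_nsmul, hy, genericDivisibility_restrict_restrict ℤ hsub]

/-- **The no-go in the binder shape of crux C2** (`GenericDivisibilityBounded` with the witness
quantifier pulled out): for `X` smooth projective of dimension `2p` and `z ∈ H^{2p}(X(ℂ);ℤ)`, an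
`m`-uniform witness of generic divisibility gives `z ⊗ ℂ ∈ supportedClasses X (2p) 1`. [folklore] -/
theorem genericDivisibilityBounded_of_fixedWitness : ∀ ⦃p : ℕ⦄ ⦃X : SchemeOver ℂ⦄,
    IsSmoothProjective (2 * p) X → ∀ z : singularCohomology ℤ ℤ (ComplexPoints X) (2 * p),
    (∃ Z : Set X.left, IsClosed Z ∧ Z ≠ Set.univ ∧ ∀ m : ℕ, 1 ≤ m →
      ∃ y : singularCohomology ℤ ℤ (complexPointsCompl X Z) (2 * p),
        m • y = singularCohomology.map ℤ ℤ
          (⟨Subtype.val, continuous_subtype_val⟩ : C(complexPointsCompl X Z, ComplexPoints X))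
          (2 * p) z) →
    singularCohomology.ringChange (Int.castRingHom ℂ) (ComplexPoints X) (2 * p) z ∈
      supportedClasses X (2 * p) 1 :=
  fun _ _ hX _ h ↦ genericDivisibility_ringChange_mem_supportedClasses_of_fixedWitness hX h

end Summit.HodgeConjecture.HodgeConjecture.Theorems

end
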